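import Summits.KontsevichZagierPeriods.KontsevichZagierPeriods.Theorems.UnfoldedStokesStokesGenerationStubIntervalTransport
import Summits.KontsevichZagierPeriods.KontsevichZagierPeriods.Theorems.UnfoldedStokesStokesGenerationFibrewiseRungSubdivision
import Summits.KontsevichZagierPeriods.KontsevichZagierPeriods.Theorems.UnfoldedStokesStokesGenerationStubLandenLeftovers
import Summits.KontsevichZagierPeriods.KontsevichZagierPeriods.Theorems.UnfoldedStokesStokesGenerationFibrewiseClosureSum
import Summits.KontsevichZagierPeriods.KontsevichZagierPeriods.Theorems.UnfoldedStokesStokesGenerationFibrewiseClosureSmul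
import Literature.NumberTheory.Transcendental.SemialgebraicMapsProofs
import Mathlib.Analysis.SpecialFunctions.Sqrt
import Mathlib.Analysis.Calculus.ContDiff.Deriv

/-!
# `StokesGeneration` (stmt-KontsevichZagierPeriods-3586) — line `fibrewise_stokes`, stub `stub_agmRelator`

Registered stub A1 (rung 23, wave 5, lead c6) of the line `fibrewise_stokes` of the crux `StokesGeneration` (route
UnfoldedStokes): **Gauss's arithmetic–geometric-mean step** — Landen's transformation of the complete elliptic
integral of the first kind, the 2-isogeny on complete integrals — inside the economy of the residual S2
(`FibStokesDecomposable`, `Theorems/UnfoldedStokesDefs.lean`). For real algebraic `a, b > 0` put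
`I(p,q) = ∫₀^∞ dt/√((t² + p²)(t² + q²))`; Gauss: `I(a,b) = I(A,B)` with `A = (a+b)/2`, `B = √(ab)`. The cube
presentation (`t = s/(1−s)`) of `I(p,q)` is `P_{p,q}(s) = 1/√((s² + p²(1−s)²)(s² + q²(1−s)²))`, and the theorem is that
the relator `P_{a,b} − P_{A,B}` is fibrewise-Stokes decomposable on `[0,1]`.

Proof (three soft relators, transcendence-free and value-free). Let
`Q(s) = 2B/√((ab s² + a²(1−s)²)(ab s² + b²(1−s)²))`, the presentation on `(0,1)` of the full-line integral
`∫_ℝ dx/√((x² + A²)(x² + ab))` through `x = B(2s−1)/(2s(1−s))`; `Q(1 − s) = Q(s)`.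
* (i) NEWMAN'S SUBSTITUTION `x = ½(t − ab/t)`: pointwise on `(0,1)`, `½Q(s) = P_{a,b}(φ(s))·φ′(s)` with
  `φ(s) = Bs/(1 − s + Bs)` (`φ(0) = 0`, `φ(1) = 1`, `φ′ = B/(1 − s + Bs)² > 0`), a closed-form identity of square
  roots of positive rational functions; so `½Q − P_{a,b}` is Kontsevich–Zagier's rule (2) on `[0,1]`
  (`stub_intervalTransport` with `α = γ = 0`, `β = δ = 1`; here `agm_transport01`).
* (ii) `Q − g ∈ Dec` for the right half `g(u) = Q(½ + u/2)`: rung 14 (`fibStokesDecomposable_sub_subdivision`,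
  cut at `½`) gives `Q(s) − ½Q(s/2) − ½Q(½ + s/2)`, and `Q(s/2) = Q(1 − s/2) = g(1 − s)` turns the remainder into
  `½(g(1 − s) − g(s))`, a reflection relator (rung 12, `landenLeft_sub_comp_reflect_of_contDiffOn`).
* (iii) the half line against the cube: pointwise `½g(u) = P_{A,B}(χ(u))·χ′(u)` with
  `χ(u) = 2Bu/(1 − u² + 2Bu)` (`χ(0) = 0`, `χ(1) = 1`, `χ′ = 2B(1 + u²)/(1 − u² + 2Bu)² > 0`); rule (2) again.
Finally `P_{a,b} − P_{A,B} = −(½Q − P_{a,b}) + ½(Q − g) + (½g − P_{A,B})` (`fibStokesDecomposable_add/_sub/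
_const_mul`, `fibStokesDecomposable_congr_off_null` with the empty null set). The fibre derivatives demanded by
rule (2) and rung 14 are supplied abstractly: the kernels are `C¹` on `ℝ` (positive radicands) with `ℚ`-semialgebraic
graphs, so their derivatives are `ℚ`-semialgebraic (`IsSemialgebraicFunOn.fderiv_apply_single`, Basu–Pollack–Roy
Prop. 3.22) and continuous.

References: J. M. Borwein, P. B. Borwein, *Pi and the AGM* (1987), Thm. 1.1 (Gauss's AGM identity, Newman's proof);
M. Kontsevich, D. Zagier, *Periods* (2001), §1.2 rules (1)–(3); S. Basu, R. Pollack, M.-F. Roy, *Algorithms in Real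
Algebraic Geometry* (2006), Prop. 3.22; J. Bochnak, M. Coste, M.-F. Roy, *Real Algebraic Geometry* (1998), Prop. 2.2.6.
-/

noncomputable section

-- `Summit.KontsevichZagierPeriods.KontsevichZagierPeriods.…` is the tree's mandated layout (single-conjunct summit).
set_option linter.dupNamespace false

namespace Summit.KontsevichZagierPeriods.KontsevichZagierPeriods.Cruxes.StokesGeneration.FibrewiseStokes

open MeasureTheory Set
open Literature.NumberTheory.Transcendental
open Literature.NumberTheory.Transcendental.KZ
open Literature.ModelTheory.ExponentialFields (IsSemialgebraic)

/-! ## The AGM kernels `c/√((m₁s² + n₁(1−s)²)(m₂s² + n₂(1−s)²))` -/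

/-- `m s² + n (1 − s)² > 0` for `m, n > 0`. [folklore] -/
private theorem agm_quad_pos {m n : ℝ} (hm : 0 < m) (hn : 0 < n) (s : ℝ) :
    0 < m * s ^ 2 + n * (1 - s) ^ 2 := by
  rcases le_or_gt s (1 / 2) with hs | hs
  · have h : (1 / 4 : ℝ) ≤ (1 - s) ^ 2 := by nlinarith
    nlinarith [mul_nonneg hm.le (sq_nonneg s)]
  · have h : (1 / 4 : ℝ) < s ^ 2 := by nlinarith
    nlinarith [mul_nonneg hn.le (sq_nonneg (1 - s))]

/-- The AGM radicand `(m₁s² + n₁(1−s)²)(m₂s² + n₂(1−s)²)` is positive for positive parameters. [folklore] -/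
private theorem agm_radicand_pos {m₁ n₁ m₂ n₂ : ℝ} (hm₁ : 0 < m₁) (hn₁ : 0 < n₁) (hm₂ : 0 < m₂)
    (hn₂ : 0 < n₂) (s : ℝ) :
    0 < (m₁ * s ^ 2 + n₁ * (1 - s) ^ 2) * (m₂ * s ^ 2 + n₂ * (1 - s) ^ 2) :=
  mul_pos (agm_quad_pos hm₁ hn₁ s) (agm_quad_pos hm₂ hn₂ s)

/-- The AGM kernel `c/√((m₁e² + n₁(1−e)²)(m₂e² + n₂(1−e)²))` read through a `ℚ`-semialgebraic function `e` is
`ℚ`-semialgebraic (algebraic parameters, positive `m`'s and `n`'s). [cite: BochnakCosteRoy1998, Prop. 2.2.6] -/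
private theorem agm_kernel_sa {c m₁ n₁ m₂ n₂ : ℝ} (hc : IsAlgebraic ℚ c) (hm₁ : IsAlgebraic ℚ m₁)
    (hn₁ : IsAlgebraic ℚ n₁) (hm₂ : IsAlgebraic ℚ m₂) (hn₂ : IsAlgebraic ℚ n₂) (pm₁ : 0 < m₁) (pn₁ : 0 < n₁)
    (pm₂ : 0 < m₂) (pn₂ : 0 < n₂) {S : Set (Fin 1 → ℝ)} {e : (Fin 1 → ℝ) → ℝ}
    (he : IsSemialgebraicFunOn ℚ S e) :
    IsSemialgebraicFunOn ℚ S (fun z => c / Real.sqrt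
      ((m₁ * e z ^ 2 + n₁ * (1 - e z) ^ 2) * (m₂ * e z ^ 2 + n₂ * (1 - e z) ^ 2))) := by
  have hS : IsSemialgebraic ℚ S := he.isSemialgebraic_holds
  have s1 : IsSemialgebraicFunOn ℚ S (fun _ => (1:ℝ)) := by
    simpa using isSemialgebraicFunOn_const_natCast hS 1
  have k : ∀ {t : ℝ}, IsAlgebraic ℚ t → IsSemialgebraicFunOn ℚ S (fun _ => t) := fun ht =>
    isSemialgebraicFunOn_const_of_isAlgebraic hS ht
  refine (k hc).div ((((k hm₁).fun_mul (he.fun_pow 2)).fun_add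
    ((k hn₁).fun_mul ((s1.fun_sub he).fun_pow 2))).fun_mul (((k hm₂).fun_mul (he.fun_pow 2)).fun_add
    ((k hn₂).fun_mul ((s1.fun_sub he).fun_pow 2)))).fun_sqrt fun z _ => ?_
  exact (Real.sqrt_pos.2 (agm_radicand_pos pm₁ pn₁ pm₂ pn₂ (e z))).ne'

/-- The AGM kernel is `C¹` on `ℝ` (positive radicand). [folklore] -/
private theorem agm_kernel_contDiff {c m₁ n₁ m₂ n₂ : ℝ} (pm₁ : 0 < m₁) (pn₁ : 0 < n₁) (pm₂ : 0 < m₂)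
    (pn₂ : 0 < n₂) :
    ContDiff ℝ 1 (fun s => c / Real.sqrt ((m₁ * s ^ 2 + n₁ * (1 - s) ^ 2) * (m₂ * s ^ 2 + n₂ * (1 - s) ^ 2))) := by
  have h1 : ∀ s : ℝ, (m₁ * s ^ 2 + n₁ * (1 - s) ^ 2) * (m₂ * s ^ 2 + n₂ * (1 - s) ^ 2) ≠ 0 :=
    fun s => (agm_radicand_pos pm₁ pn₁ pm₂ pn₂ s).ne'
  have h2 : ∀ s : ℝ, Real.sqrt ((m₁ * s ^ 2 + n₁ * (1 - s) ^ 2) * (m₂ * s ^ 2 + n₂ * (1 - s) ^ 2)) ≠ 0 :=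
    fun s => (Real.sqrt_pos.2 (agm_radicand_pos pm₁ pn₁ pm₂ pn₂ s)).ne'
  fun_prop (disch := assumption)

/-- Square-root bookkeeping of the two pointwise identities: `c/(2√X) = (1/√Y)·(p/q)` as soon as
`c²q²Y = 4p²X` (everything positive). [folklore] -/
private theorem agm_div_sqrt_eq {c p q X Y : ℝ} (hc : 0 < c) (hp : 0 < p) (hq : 0 < q) (hX : 0 < X)
    (hY : 0 < Y) (h : c ^ 2 * q ^ 2 * Y = 4 * p ^ 2 * X) :
    c / Real.sqrt X / 2 = 1 / Real.sqrt Y * (p / q) := by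
  have hsX := Real.sqrt_pos.2 hX
  have hsY := Real.sqrt_pos.2 hY
  have key : Real.sqrt Y = 2 * p * Real.sqrt X / (c * q) := by
    rw [eq_div_iff (by positivity), ← sq_eq_sq₀ (by positivity) (by positivity)]
    simp only [mul_pow, Real.sq_sqrt hY.le, Real.sq_sqrt hX.le]
    linear_combination h
  rw [key]
  field_simp

/-! ## One-variable `C¹` semialgebraic data: derivative, rule (2) on `[0,1]`, subdivision at `½` -/

/-- The slab `{z | z 0 ∈ [0,1]}` of `ℝ¹` is the unit cube, hence `ℚ`-semialgebraic. [folklore] -/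
private theorem agm_isSemialgebraic_slab :
    IsSemialgebraic ℚ {z : Fin 1 → ℝ | z 0 ∈ Set.Icc (0:ℝ) 1} := by
  convert isSemialgebraic_cubePi_one using 1
  ext z
  rw [Set.mem_setOf_eq, Set.mem_univ_pi, Fin.forall_fin_one]

/-- The derivative of a `C¹` function of one variable whose graph is `ℚ`-semialgebraic is `ℚ`-semialgebraic
(partial derivative of the reading `z ↦ k (z 0)` on `ℝ¹`). [cite: BasuPollackRoy2006, Prop. 3.22] -/
private theorem agm_deriv_sa (k : ℝ → ℝ) (hk : ContDiff ℝ 1 k)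
    (hsa : IsSemialgebraicFunOn ℚ (Set.univ : Set (Fin 1 → ℝ)) (fun z => k (z 0))) :
    IsSemialgebraicFunOn ℚ (Set.univ : Set (Fin 1 → ℝ)) (fun z => deriv k (z 0)) := by
  have hdiff : ∀ x ∈ (Set.univ : Set (Fin 1 → ℝ)), DifferentiableAt ℝ (fun z : Fin 1 → ℝ => k (z 0)) x :=
    fun x _ => ((hk.differentiable one_ne_zero) (x 0)).comp x (differentiableAt_apply 0 x)
  refine (hsa.fderiv_apply_single isOpen_univ hdiff 0).congr fun x _ => ?_
  have key := ((hdiff (Function.update x 0 (x 0)) trivial).hasFDerivAt).comp_hasDerivAt (x 0)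
    (hasDerivAt_update x 0 (x 0))
  have e : (fun z : Fin 1 → ℝ => k (z 0)) ∘ Function.update x 0 = k := by
    ext s
    simp
  rw [Function.update_eq_self, e] at key
  exact key.deriv.symm

/-- **Rule (2) on `[0,1]` for a `C¹` target kernel** (`stub_intervalTransport` with `α = γ = 0`, `β = δ = 1`, the
derivative of `k₂` supplied by `agm_deriv_sa`): if `φ` fixes `0` and `1`, maps `(0,1)` into itself and
`k₁ = (k₂∘φ)·φ′` on `(0,1)`, then `k₁ − k₂` is fibrewise-Stokes decomposable.
[cite: KontsevichZagier2001, §1.2 rule (2)] -/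
private theorem agm_transport01 (k₁ k₂ φ φ' : ℝ → ℝ) (hk₂ : ContDiff ℝ 1 k₂)
    (hk₂sa : IsSemialgebraicFunOn ℚ (Set.univ : Set (Fin 1 → ℝ)) (fun z => k₂ (z 0)))
    (hk₁ : IsSemialgebraicFunOn ℚ {z : Fin 1 → ℝ | z 0 ∈ Set.Icc (0:ℝ) 1} (fun z => k₁ (z 0)))
    (hk₁c : ContinuousOn k₁ (Set.Icc (0:ℝ) 1))
    (hφ : IsSemialgebraicFunOn ℚ {z : Fin 1 → ℝ | z 0 ∈ Set.Icc (0:ℝ) 1} (fun z => φ (z 0)))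
    (hφ' : IsSemialgebraicFunOn ℚ {z : Fin 1 → ℝ | z 0 ∈ Set.Icc (0:ℝ) 1} (fun z => φ' (z 0)))
    (hφc : ContinuousOn φ (Set.Icc (0:ℝ) 1)) (hφ'c : ContinuousOn φ' (Set.Icc (0:ℝ) 1))
    (hφd : ∀ u ∈ Set.Ioo (0:ℝ) 1, HasDerivAt φ (φ' u) u) (hφ0 : φ 0 = 0) (hφ1 : φ 1 = 1)
    (hφI : ∀ u ∈ Set.Ioo (0:ℝ) 1, φ u ∈ Set.Ioo (0:ℝ) 1)
    (hrel : ∀ u ∈ Set.Ioo (0:ℝ) 1, k₁ u = k₂ (φ u) * φ' u) :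
    FibStokesDecomposable 1 (fun z => k₁ (z 0) - k₂ (z 0)) := by
  have hslab := agm_isSemialgebraic_slab
  have hT := stub_intervalTransport 0 1 0 1 zero_lt_one zero_lt_one isAlgebraic_zero isAlgebraic_one
    isAlgebraic_zero isAlgebraic_one k₁ k₂ (deriv k₂) φ φ' hk₁ (hk₂sa.mono (Set.subset_univ _) hslab)
    ((agm_deriv_sa k₂ hk₂ hk₂sa).mono (Set.subset_univ _) hslab) hφ hφ' hk₁c hk₂.continuous.continuousOn
    (hk₂.continuous_deriv le_rfl).continuousOn hφc hφ'c
    (fun u _ => ((hk₂.differentiable one_ne_zero) u).hasDerivAt) hφd hφ0 hφ1 hφI hrel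
  refine fibStokesDecomposable_congr_off_null 1 _ _ ∅
    Literature.ModelTheory.ExponentialFields.isSemialgebraic_empty measure_empty (fun x _ _ => ?_) hT
  simp

/-- **Subdivision at `½` for a `C¹` kernel** (rung 14 `fibStokesDecomposable_sub_subdivision` in dimension one, the
fibre derivative supplied by `agm_deriv_sa`): `Q(s) − ½Q(s/2) − ½Q(½ + s/2)` is fibrewise-Stokes decomposable.
[cite: KontsevichZagier2001, §1.2 rules (1), (2), (3)] -/
private theorem agm_sub_subdivision (Q : ℝ → ℝ) (hQ : ContDiff ℝ 1 Q)
    (hQsa : IsSemialgebraicFunOn ℚ (Set.univ : Set (Fin 1 → ℝ)) (fun z => Q (z 0))) :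
    FibStokesDecomposable 1 (fun z => Q (z 0) - 1 / 2 * Q (1 / 2 * z 0) - 1 / 2 * Q (1 / 2 + 1 / 2 * z 0)) := by
  have hC := isSemialgebraic_cubePi_one
  have h2 : IsAlgebraic ℚ (1 / 2 : ℝ) := by
    have h := isAlgebraic_rat ℚ (A := ℝ) (1 / 2)
    push_cast at h
    exact h
  have hI : (1 / 2 : ℝ) ∈ Set.Ioo (0:ℝ) 1 := by norm_num
  have key := fibStokesDecomposable_sub_subdivision (0 : Fin 1) (1 / 2) h2 hI (fun x => Q (x 0))
    (fun x => deriv Q (x 0)) (hQsa.mono (Set.subset_univ _) hC)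
    ((agm_deriv_sa Q hQ hQsa).mono (Set.subset_univ _) hC)
    (hQ.continuous.comp (continuous_apply 0)).continuousOn
    ((hQ.continuous_deriv le_rfl).comp (continuous_apply 0)).continuousOn
    (fun x _ _ => by simpa using ((hQ.differentiable one_ne_zero) (x 0)).hasDerivAt)
  refine fibStokesDecomposable_congr_off_null 1 _ _ ∅
    Literature.ModelTheory.ExponentialFields.isSemialgebraic_empty measure_empty (fun x _ _ => ?_) key
  simp only [Function.update_self]
  norm_num

/-! ## Gauss's arithmetic–geometric-mean step -/

/-- **Registered stub `stub_agmRelator` (A1, rung 23): Gauss's AGM step (Landen's transformation of the complete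
elliptic integral of the first kind) is fibrewise-Stokes decomposable.** For real algebraic `a, b > 0`, with
`P_{p,q}(s) = 1/√((s² + p²(1−s)²)(s² + q²(1−s)²))` the cube presentation (`t = s/(1−s)`) of
`I(p,q) = ∫₀^∞ dt/√((t²+p²)(t²+q²))`, the relator `P_{a,b} − P_{(a+b)/2,√(ab)}` of Gauss's identity
`I(a,b) = I((a+b)/2, √(ab))` is decomposable: with `B = √(ab)` and the full-line presentation
`Q(s) = 2B/√((ab s² + a²(1−s)²)(ab s² + b²(1−s)²))`, (i) `½Q − P_{a,b}` is a rule-(2) relator on `[0,1]`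
(Newman's substitution, `φ(s) = Bs/(1 − s + Bs)`), (ii) `Q − Q(½ + s/2)` is a subdivision relator at `½` plus a
reflection relator (`Q(1 − s) = Q(s)`), (iii) `½Q(½ + u/2) − P_{(a+b)/2,B}` is a rule-(2) relator on `[0,1]`
(`χ(u) = 2Bu/(1 − u² + 2Bu)`). Transcendence-free and value-free. [cite: BorweinBorwein1987, Thm 1.1] -/
theorem stub_agmRelator (a b : ℝ) (ha : IsAlgebraic ℚ a) (hb : IsAlgebraic ℚ b) (ha0 : 0 < a) (hb0 : 0 < b) :
    FibStokesDecomposable 1 (fun z =>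
      1 / Real.sqrt ((z 0 ^ 2 + a ^ 2 * (1 - z 0) ^ 2) * (z 0 ^ 2 + b ^ 2 * (1 - z 0) ^ 2)) -
        1 / Real.sqrt ((z 0 ^ 2 + ((a + b) / 2) ^ 2 * (1 - z 0) ^ 2) * (z 0 ^ 2 + a * b * (1 - z 0) ^ 2))) := by
  -- constants: `B = √(ab)`, `B² = ab`; everything in sight is algebraic
  have hab : 0 < a * b := mul_pos ha0 hb0
  obtain ⟨B, hB⟩ : ∃ B : ℝ, B = Real.sqrt (a * b) := ⟨_, rfl⟩
  have hB0 : 0 < B := by rw [hB]; exact Real.sqrt_pos.2 hab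
  have hB2 : B ^ 2 = a * b := by rw [hB]; exact Real.sq_sqrt hab.le
  have hBalg : IsAlgebraic ℚ B := (show IsAlgebraic ℚ (B ^ 2) by rw [hB2]; exact ha.mul hb).of_pow two_pos
  have h2 : IsAlgebraic ℚ (2:ℝ) := by simpa using isAlgebraic_nat (R := ℚ) (A := ℝ) 2
  have hhalf : IsAlgebraic ℚ (1 / 2 : ℝ) := by
    have h := isAlgebraic_rat ℚ (A := ℝ) (1 / 2)
    push_cast at h
    exact h
  have pa2 : 0 < a ^ 2 := pow_pos ha0 2
  have pb2 : 0 < b ^ 2 := pow_pos hb0 2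
  have pA2 : 0 < ((a + b) / 2) ^ 2 := by positivity
  have a2alg : IsAlgebraic ℚ (a ^ 2) := ha.pow 2
  have b2alg : IsAlgebraic ℚ (b ^ 2) := hb.pow 2
  have abalg : IsAlgebraic ℚ (a * b) := ha.mul hb
  have A2alg : IsAlgebraic ℚ (((a + b) / 2) ^ 2) := by
    rw [div_eq_mul_inv]
    exact ((ha.add hb).mul h2.inv).pow 2
  have cBalg : IsAlgebraic ℚ (2 * B) := h2.mul hBalg
  -- the cube presentations `P = P_{a,b}`, `P' = P_{A,B}`, the full-line presentation `Q`, its right half `g`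
  obtain ⟨P, hP⟩ : ∃ P : ℝ → ℝ, P = fun s =>
      1 / Real.sqrt ((1 * s ^ 2 + a ^ 2 * (1 - s) ^ 2) * (1 * s ^ 2 + b ^ 2 * (1 - s) ^ 2)) := ⟨_, rfl⟩
  obtain ⟨P', hP'⟩ : ∃ P' : ℝ → ℝ, P' = fun s =>
      1 / Real.sqrt ((1 * s ^ 2 + ((a + b) / 2) ^ 2 * (1 - s) ^ 2) * (1 * s ^ 2 + a * b * (1 - s) ^ 2)) :=
    ⟨_, rfl⟩
  obtain ⟨Q, hQ⟩ : ∃ Q : ℝ → ℝ, Q = fun s =>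
      2 * B / Real.sqrt ((a * b * s ^ 2 + a ^ 2 * (1 - s) ^ 2) * (a * b * s ^ 2 + b ^ 2 * (1 - s) ^ 2)) :=
    ⟨_, rfl⟩
  obtain ⟨g, hg⟩ : ∃ g : ℝ → ℝ, g = fun u => Q (1 / 2 + 1 / 2 * u) := ⟨_, rfl⟩
  -- regularity and semialgebraicity of the four kernels
  have hPd : ContDiff ℝ 1 P := by rw [hP]; exact agm_kernel_contDiff one_pos pa2 one_pos pb2
  have hP'd : ContDiff ℝ 1 P' := by rw [hP']; exact agm_kernel_contDiff one_pos pA2 one_pos hab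
  have hQd : ContDiff ℝ 1 Q := by rw [hQ]; exact agm_kernel_contDiff hab pa2 hab pb2
  have hgd : ContDiff ℝ 1 g := by rw [hg]; fun_prop
  have hU : IsSemialgebraic ℚ (Set.univ : Set (Fin 1 → ℝ)) :=
    Literature.ModelTheory.ExponentialFields.isSemialgebraic_univ
  have sx : IsSemialgebraicFunOn ℚ (Set.univ : Set (Fin 1 → ℝ)) (fun z => z 0) :=
    isSemialgebraicFunOn_apply hU 0
  have shalf : IsSemialgebraicFunOn ℚ (Set.univ : Set (Fin 1 → ℝ)) (fun _ => (1 / 2 : ℝ)) :=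
    (isSemialgebraicFunOn_const_ratCast hU (1 / 2)).congr fun _ _ => by norm_num
  have hPsa : IsSemialgebraicFunOn ℚ (Set.univ : Set (Fin 1 → ℝ)) (fun z => P (z 0)) := by
    rw [hP]
    exact agm_kernel_sa isAlgebraic_one isAlgebraic_one a2alg isAlgebraic_one b2alg one_pos pa2 one_pos pb2 sx
  have hP'sa : IsSemialgebraicFunOn ℚ (Set.univ : Set (Fin 1 → ℝ)) (fun z => P' (z 0)) := by
    rw [hP']
    exact agm_kernel_sa isAlgebraic_one isAlgebraic_one A2alg isAlgebraic_one abalg one_pos pA2 one_pos hab sx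
  have hQsa : IsSemialgebraicFunOn ℚ (Set.univ : Set (Fin 1 → ℝ)) (fun z => Q (z 0)) := by
    rw [hQ]
    exact agm_kernel_sa cBalg abalg a2alg abalg b2alg hab pa2 hab pb2 sx
  have hgsa : IsSemialgebraicFunOn ℚ (Set.univ : Set (Fin 1 → ℝ)) (fun z => g (z 0)) := by
    rw [hg, hQ]
    exact agm_kernel_sa cBalg abalg a2alg abalg b2alg hab pa2 hab pb2 (shalf.fun_add (shalf.fun_mul sx))
  -- semialgebraic atoms on the slab `{z | z 0 ∈ [0,1]}`
  have hS := agm_isSemialgebraic_slab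
  have hSU : {z : Fin 1 → ℝ | z 0 ∈ Set.Icc (0:ℝ) 1} ⊆ Set.univ := Set.subset_univ _
  have sxS : IsSemialgebraicFunOn ℚ {z : Fin 1 → ℝ | z 0 ∈ Set.Icc (0:ℝ) 1} (fun z => z 0) :=
    isSemialgebraicFunOn_apply hS 0
  have s1S : IsSemialgebraicFunOn ℚ {z : Fin 1 → ℝ | z 0 ∈ Set.Icc (0:ℝ) 1} (fun _ => (1:ℝ)) := by
    simpa using isSemialgebraicFunOn_const_natCast hS 1
  have s2S : IsSemialgebraicFunOn ℚ {z : Fin 1 → ℝ | z 0 ∈ Set.Icc (0:ℝ) 1} (fun _ => (2:ℝ)) :=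
    isSemialgebraicFunOn_const_ofNat hS 2
  have cBS : IsSemialgebraicFunOn ℚ {z : Fin 1 → ℝ | z 0 ∈ Set.Icc (0:ℝ) 1} (fun _ => B) :=
    isSemialgebraicFunOn_const_of_isAlgebraic hS hBalg
  -- (i) Newman's substitution: `½Q − P ∈ Dec` by rule (2) on `[0,1]` along `φ(s) = Bs/(1 − s + Bs)`
  have hD : ∀ s ∈ Set.Icc (0:ℝ) 1, 0 < 1 - s + B * s := by
    intro s hs
    rcases hs.2.eq_or_lt with h1 | h1
    · rw [h1]; linarith
    · nlinarith [mul_nonneg hB0.le hs.1]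
  have hDne : ∀ s ∈ Set.Icc (0:ℝ) 1, 1 - s + B * s ≠ 0 := fun s hs => (hD s hs).ne'
  have hDne2 : ∀ s ∈ Set.Icc (0:ℝ) 1, (1 - s + B * s) ^ 2 ≠ 0 := fun s hs => pow_ne_zero 2 (hDne s hs)
  have hi : FibStokesDecomposable 1 (fun z => Q (z 0) / 2 - P (z 0)) := by
    refine agm_transport01 (fun s => Q s / 2) P (fun s => B * s / (1 - s + B * s))
      (fun s => B / (1 - s + B * s) ^ 2) hPd hPsa ((hQsa.mono hSU hS).div s2S fun _ _ => two_ne_zero)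
      (hQd.continuous.continuousOn.div_const _)
      ((cBS.fun_mul sxS).div ((s1S.fun_sub sxS).fun_add (cBS.fun_mul sxS)) fun z hz => hDne _ hz)
      (cBS.div (((s1S.fun_sub sxS).fun_add (cBS.fun_mul sxS)).fun_pow 2) fun z hz => hDne2 _ hz)
      (by fun_prop (disch := assumption)) (by fun_prop (disch := assumption)) (fun u hu => ?_) (by simp)
      (by rw [mul_one, sub_self, zero_add, div_self hB0.ne']) (fun u hu => ?_) (fun u hu => ?_)
    · -- `φ′ = B/(1 − s + Bs)²`
      have hDu := hDne u (Set.Ioo_subset_Icc_self hu)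
      have hx := hasDerivAt_id' u
      exact ((hx.const_mul B).fun_div ((hx.const_sub 1).fun_add (hx.const_mul B)) hDu).congr_deriv
        (by field_simp; ring)
    · -- `φ` maps `(0,1)` into `(0,1)`
      have hDu := hD u (Set.Ioo_subset_Icc_self hu)
      exact ⟨div_pos (mul_pos hB0 hu.1) hDu, (div_lt_one hDu).2 (by linarith [hu.2])⟩
    · -- Newman's identity `½Q(s) = P(φ(s))·φ′(s)`
      have hDu := hD u (Set.Ioo_subset_Icc_self hu)
      have hDne' := hDu.ne'
      simp only [hQ, hP]
      refine agm_div_sqrt_eq (mul_pos two_pos hB0) hB0 (pow_pos hDu 2) (agm_radicand_pos hab pa2 hab pb2 u)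
        (agm_radicand_pos one_pos pa2 one_pos pb2 _) ?_
      rw [← hB2]
      field_simp
      ring
  -- (ii) `Q − g ∈ Dec`: subdivision at `½` (rung 14) and the reflection of `g` (rung 12), by `Q(1 − s) = Q(s)`
  have hQsymm : ∀ t, Q (1 - t) = Q t := fun t => by
    simp only [hQ]
    exact congrArg (fun r => 2 * B / Real.sqrt r) (by ring)
  have hrefl := landenLeft_sub_comp_reflect_of_contDiffOn Set.univ isOpen_univ (Set.subset_univ _)
    (fun x => g (x 0)) hgsa (by fun_prop) 0
  have hii : FibStokesDecomposable 1 (fun z => Q (z 0) - g (z 0)) := by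
    refine fibStokesDecomposable_congr_off_null 1 _ _ ∅
      Literature.ModelTheory.ExponentialFields.isSemialgebraic_empty measure_empty (fun x _ _ => ?_)
      (fibStokesDecomposable_sub 1 _ _ (agm_sub_subdivision Q hQd hQsa)
        (fibStokesDecomposable_const_mul 1 (1 / 2) _ hhalf hrefl))
    have e1 : g (1 - x 0) = Q (1 / 2 * x 0) := by
      have e : (1 / 2 + 1 / 2 * (1 - x 0) : ℝ) = 1 - 1 / 2 * x 0 := by ring
      rw [hg]
      beta_reduce
      rw [e, hQsymm]
    have e2 : g (x 0) = Q (1 / 2 + 1 / 2 * x 0) := by rw [hg]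
    simp only [Function.update_self]
    rw [e1, e2]
    ring
  -- (iii) the half line: `½g − P' ∈ Dec` by rule (2) on `[0,1]` along `χ(u) = 2Bu/(1 − u² + 2Bu)`
  have hE : ∀ u ∈ Set.Icc (0:ℝ) 1, 0 < 1 - u ^ 2 + 2 * B * u := by
    intro u hu
    rcases hu.2.eq_or_lt with h1 | h1
    · rw [h1]; linarith
    · nlinarith [mul_nonneg hB0.le hu.1, hu.1]
  have hEne : ∀ u ∈ Set.Icc (0:ℝ) 1, 1 - u ^ 2 + 2 * B * u ≠ 0 := fun u hu => (hE u hu).ne'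
  have hEne2 : ∀ u ∈ Set.Icc (0:ℝ) 1, (1 - u ^ 2 + 2 * B * u) ^ 2 ≠ 0 := fun u hu =>
    pow_ne_zero 2 (hEne u hu)
  have haB : a = B ^ 2 / b := by rw [hB2, mul_div_assoc, div_self hb0.ne', mul_one]
  have hbne : b ≠ 0 := hb0.ne'
  have hiii : FibStokesDecomposable 1 (fun z => g (z 0) / 2 - P' (z 0)) := by
    have sE := (s1S.fun_sub (sxS.fun_pow 2)).fun_add ((s2S.fun_mul cBS).fun_mul sxS)
    refine agm_transport01 (fun u => g u / 2) P' (fun u => 2 * B * u / (1 - u ^ 2 + 2 * B * u))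
      (fun u => 2 * B * (1 + u ^ 2) / (1 - u ^ 2 + 2 * B * u) ^ 2) hP'd hP'sa
      ((hgsa.mono hSU hS).div s2S fun _ _ => two_ne_zero) (hgd.continuous.continuousOn.div_const _)
      (((s2S.fun_mul cBS).fun_mul sxS).div sE fun z hz => hEne _ hz)
      (((s2S.fun_mul cBS).fun_mul (s1S.fun_add (sxS.fun_pow 2))).div (sE.fun_pow 2) fun z hz => hEne2 _ hz)
      (by fun_prop (disch := assumption)) (by fun_prop (disch := assumption)) (fun u hu => ?_) (by simp)
      ?_ (fun u hu => ?_) (fun u hu => ?_)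
    · -- `χ′ = 2B(1 + u²)/(1 − u² + 2Bu)²`
      have hEu := hEne u (Set.Ioo_subset_Icc_self hu)
      have hx := hasDerivAt_id' u
      have hden := ((hx.pow 2).const_sub 1).fun_add (hx.const_mul (2 * B))
      norm_num at hden
      exact ((hx.const_mul (2 * B)).fun_div hden hEu).congr_deriv (by field_simp; ring)
    · -- `χ 1 = 1`
      rw [one_pow, sub_self, zero_add]
      exact div_self (mul_pos (mul_pos two_pos hB0) one_pos).ne'
    · -- `χ` maps `(0,1)` into `(0,1)`
      have hEu := hE u (Set.Ioo_subset_Icc_self hu)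
      exact ⟨div_pos (mul_pos (mul_pos two_pos hB0) hu.1) hEu,
        (div_lt_one hEu).2 (by nlinarith [hu.1, hu.2])⟩
    · -- the half-line identity `½Q(½ + u/2) = P'(χ(u))·χ′(u)`
      have hEu := hE u (Set.Ioo_subset_Icc_self hu)
      have hEne' := hEu.ne'
      simp only [hg, hQ, hP']
      refine agm_div_sqrt_eq (mul_pos two_pos hB0) (mul_pos (mul_pos two_pos hB0) (by positivity))
        (pow_pos hEu 2) (agm_radicand_pos hab pa2 hab pb2 _) (agm_radicand_pos one_pos pA2 one_pos hab _) ?_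
      rw [haB]
      field_simp
      ring
  -- `P − P' = −(½Q − P) + ½(Q − g) + (½g − P')`
  have hfin := fibStokesDecomposable_add 1 _ _
    (fibStokesDecomposable_sub 1 _ _ (fibStokesDecomposable_const_mul 1 (1 / 2) _ hhalf hii) hi) hiii
  refine fibStokesDecomposable_congr_off_null 1 _ _ ∅
    Literature.ModelTheory.ExponentialFields.isSemialgebraic_empty measure_empty (fun x _ _ => ?_) hfin
  simp only [hP, hP', one_mul]
  ring

end Summit.KontsevichZagierPeriods.KontsevichZagierPeriods.Cruxes.StokesGeneration.FibrewiseStokes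

end
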